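import Literature.AlgebraicGeometry.ModuliOfAbelianVarieties.Lan2013.Sec131QuasiIsogenies
import Literature.AlgebraicGeometry.Morphisms.RigidityLemmaStein
import Literature.AlgebraicGeometry.AbelianSchemes.AbelianSchemeOverIsogenyFinite
import Literature.AlgebraicGeometry.AbelianSchemes.AbelianSchemeOverLevelBaseChange
import Literature.AlgebraicGeometry.Motives.AbelianVarietyTorsionProofs
import HarnessLib

/-!
# [Lan2013] §1.3.1 — companion proofs (`…Holds`) for `Sec131QuasiIsogenies.lean`: the rigidity lemma, Prop. 1.3.1.4

[cite: Lan2013PELCompactifications, Prop. 1.3.1.4 (p. 58)] [cite: MumfordFogartyKirwan1994, Ch. 6 §1 Proposition 6.1 (pp. 115–116)]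
Squad-TS companion (RULING TS-1: theorems only, no new named fact) discharging `Lan2013_1314_rigidity` — the RIGIDITY LEMMA in the
printed hypotheses: `p : X → S` closed and open ON THE UNDERLYING MAP, with a section `e`, `q : Y → S` separated, `S` connected,
`𝒪_S → p_*𝒪_X` an isomorphism (bijectivity of every `Γ(W, 𝒪_S) → Γ(p⁻¹W, 𝒪_X)`), and `f : X → Y` over `S` contracting one fibre
set-theoretically; then `f = f ∘ e ∘ p`.  The tree's ★ `Morphisms.RigidityLemmaStein.rigidity_of_surjective` is this statement under the
INSTANCES `[UniversallyClosed p] [UniversallyOpen p]`; its proof ([MFK] Prop. 6.1: equaliser closed since `q` is separated; tube lemma;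
the contracted locus is clopen; the tubes on which `f` and `f ∘ e ∘ p` agree cover `X`) uses of them only that `p` is a closed and an
open MAP, so it is re-run here verbatim with those two as hypotheses (`rigidity_of_surjective_of_isClosedMap`), reusing ★
`comp_eq_comp_of_forall_mem_affineOpen_of_surjective`, ★ `isOpen_setOf_fiber_subset` and ★ `surjective_morphismRestrict_appTop_of_bijective_app`
by import.  (Flatness and local noetherianity, printed, are carried by the fact and not used — as in print, where they only serve
«`p` open» and the reduction to [EGA].)

EDITION 2 (squad TS, typer TS-t02 (g4); edition 1 byte-untouched above `section IsogenyFibres`; three imports added) discharges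
`Lan2013_13112_kernel_finite_flat` — [cite: Lan2013PELCompactifications, Cor. 1.3.1.12 (p. 60)] «the kernel `ker(f)` [of an isogeny
`f : A → A′` of abelian schemes] is finite flat and of finite presentation. Hence, the rank of `ker(f)` is locally constant» — and
`Lan2013_13118_faithful` — [cite: Lan2013PELCompactifications, Lem. 1.3.1.18 (p. 61)], the faithfulness half: `i ≫ f = i ≫ f′` with
`i` an isogeny forces `f = f′` — over an ARBITRARY base, without print's reduction to the noetherian case (Thm. 1.3.1.3, [EGA IV₃]
§8): the tree's critère de platitude par fibres over any base (★ `Morphisms.FlatOfFlatFibres`, [EGA IV₃] 11.3.10 + fpqc descent) and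
★ `AbelianSchemeOverIsogenyFinite` ∕ ★ `PolarizationLamEtale` ([GortzWedhorn2023] Cor. 27.177 (1): a homomorphism of abelian schemes
whose geometric fibres are isogenies is finite, flat and surjective, with finite locally free kernel) reduce both to ONE bridge lemma,
`isIsogeny_fibreHom_of_isIsogeny`: an isogeny in the sense of Def. 1.3.1.9 (surjective homomorphism with quasi-finite kernel
`ker(f) → S`) has fibres `f_t : A_t → A′_t` that are isogenies of abelian varieties (finite and surjective) at every field-valued point
`t`.  Its proof: the kernel of `f_t` is the base change of `ker(f)` along `t` (`isPullback_ker_fibreHom`, pasting the cartesian squares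
★ `GroupSchemeKernel.isPullback_kerι_left`, ★ `Limits.isPullback_pullback_map_left` along ★ `one_baseChange_left_comp_fst`), hence
quasi-finite and proper over `Spec Ω`, hence finite (Zariski's main theorem, Mathlib `IsFinite.of_isProper_of_locallyQuasiFinite`),
so `f_t` is finite (★ `AbelianVariety.isFinite_toSchemeHom_of_isFinite_kerToSpec`, the translation argument of [GortzWedhorn2023]
Prop. 27.176) and surjective (base change).  Then Cor. 1.3.1.12: `f` is finite, flat ([MumfordFogartyKirwan1994] Lemma 6.12) and
locally of finite presentation, so is its base change `ker(f) → S` along `e_{A′}`, whose rank is locally constant (Mathlib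
`Scheme.Hom.isLocallyConstant_finrank`); Lem. 1.3.1.18: `i` is flat and surjective, hence an epimorphism of schemes (Mathlib
`epi_of_flat_of_surjective`).
-/

noncomputable section

open CategoryTheory CategoryTheory.Limits AlgebraicGeometry TopologicalSpace

namespace Literature.AlgebraicGeometry.ModuliOfAbelianVarieties.Lan2013.Sec131QuasiIsogenies

open Literature.AlgebraicGeometry.Morphisms

universe u'

variable {X Y S : Scheme.{u'}}

/-- **Rigidity lemma, Stein form, for `p` a CLOSED and OPEN MAP** ([MFK] Prop. 6.1 = [Lan2013] Prop. 1.3.1.4): ★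
`rigidity_of_surjective` with `[UniversallyClosed p] [UniversallyOpen p]` weakened to `IsClosedMap p.base`, `IsOpenMap p.base` (the
same proof: the equaliser `E ↪ X` of `f` and `p ≫ ε ≫ f` is closed (`q` separated); a contracted fibre has a tube mapped into one
affine open, on which the two morphisms agree because every function on the tube comes from the base; the set of base points whose
fibre lies in `E` is closed (`p` open) and open (tube lemma, `p` closed), contains `s₀`, hence is all of the preconnected `S`).
[cite: MumfordFogartyKirwan1994, Ch. 6 §1 Proposition 6.1 (pp. 115–116)] [cite: Lan2013PELCompactifications, Prop. 1.3.1.4 (p. 58)] -/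
theorem rigidity_of_surjective_of_isClosedMap {p : X ⟶ S} {q : Y ⟶ S} (hpc : IsClosedMap p.base) (hpo : IsOpenMap p.base)
    [IsSeparated q] [PreconnectedSpace S] (f : X ⟶ Y) (hf : f ≫ q = p) (ε : S ⟶ X) (hε : ε ≫ p = 𝟙 S)
    (hStein : ∀ W : S.Opens, Function.Surjective (p ∣_ W).appTop.hom)
    {s₀ : S} {y₀ : Y} (h₀ : ∀ x : X, p.base x = s₀ → f.base x = y₀) :
    f = p ≫ ε ≫ f := by
  have hg : (p ≫ ε ≫ f) ≫ q = p := by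
    rw [Category.assoc, Category.assoc, hf, hε, Category.comp_id]
  -- the equaliser of `f` and `p ≫ ε ≫ f` in `Over S`: a closed subscheme of `X` since `q` is separated
  let X' : Over S := Over.mk p
  let Y' : Over S := Over.mk q
  let f' : X' ⟶ Y' := Over.homMk f hf
  let g' : X' ⟶ Y' := Over.homMk (p ≫ ε ≫ f) hg
  haveI : IsSeparated Y'.hom := ‹IsSeparated q›
  let ι : (equalizer f' g').left ⟶ X := (equalizer.ι f' g').left
  have hι : ι ≫ f = ι ≫ p ≫ ε ≫ f := congrArg CommaMorphism.left (equalizer.condition f' g')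
  haveI : IsClosedImmersion ι := isClosedImmersion_equalizer_ι_left f' g'
  let E : Set X := Set.range ι.base
  have hEc : IsClosed E := ι.isClosedEmbedding.isClosed_range
  -- (b) if `f` and `p ≫ ε ≫ f` agree on the tube over `W`, every fibre over `W` lies in `E`
  have hb : ∀ W : S.Opens, (p ⁻¹ᵁ W).ι ≫ f = (p ⁻¹ᵁ W).ι ≫ p ≫ ε ≫ f →
      ∀ x : X, p.base x ∈ W → x ∈ E := by
    intro W hW x hx
    obtain ⟨x', rfl⟩ : x ∈ Set.range (p ⁻¹ᵁ W).ι.base := by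
      rw [Scheme.Opens.range_ι]
      exact hx
    let t : Over.mk ((p ⁻¹ᵁ W).ι ≫ p) ⟶ X' := Over.homMk (p ⁻¹ᵁ W).ι rfl
    have ht : t ≫ f' = t ≫ g' := by
      ext : 1
      exact hW
    refine ⟨(equalizer.lift t ht).left.base x', ?_⟩
    rw [← Scheme.Hom.comp_apply]
    change (equalizer.lift t ht ≫ equalizer.ι f' g').left.base x' = _
    rw [equalizer.lift_ι]
    rfl
  -- points of `E` have `f x = f (ε (p x))`
  have hpt : ∀ x ∈ E, f.base x = f.base (ε.base (p.base x)) := by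
    rintro _ ⟨y, rfl⟩
    rw [← Scheme.Hom.comp_apply, ← Scheme.Hom.comp_apply, ← Scheme.Hom.comp_apply, ← Scheme.Hom.comp_apply, hι]
  -- (K) a set-theoretically contracted fibre has a TUBE on which `f = p ≫ ε ≫ f`
  have hK : ∀ (s : S) (y : Y), (∀ x : X, p.base x = s → f.base x = y) →
      ∃ W : S.Opens, s ∈ W ∧ (p ⁻¹ᵁ W).ι ≫ f = (p ⁻¹ᵁ W).ι ≫ p ≫ ε ≫ f := by
    intro s y hy
    obtain ⟨V, hV, hyV, -⟩ := exists_isAffineOpen_mem_and_subset (X := Y) (x := y) (U := ⊤) trivial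
    let W : S.Opens := ⟨{u : S | ∀ x : X, p.base x = u → x ∈ f ⁻¹ᵁ V}, isOpen_setOf_fiber_subset p hpc (f ⁻¹ᵁ V)⟩
    refine ⟨W, fun x hx => ?_, comp_eq_comp_of_forall_mem_affineOpen_of_surjective f ε hε W (hStein W) hV ?_⟩
    · show f.base x ∈ V
      rw [hy x hx]
      exact hyV
    · intro x hx
      exact hx x rfl
  -- the set `T` of base points whose whole fibre lies in `E`
  let T : Set S := {s : S | ∀ x : X, p.base x = s → x ∈ E}
  -- `T` is closed (`p` is open) and open
  have hTc : IsClosed T := by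
    have hT : T = (p.base '' Eᶜ)ᶜ := by
      ext s
      simp only [T, Set.mem_setOf_eq, Set.mem_compl_iff, Set.mem_image, not_exists, not_and]
      constructor
      · intro h x hx hxs
        exact hx (h x hxs)
      · intro h x hxs
        by_contra hx
        exact h x hx hxs
    rw [hT, ← isOpen_compl_iff, compl_compl]
    exact hpo _ hEc.isOpen_compl
  have hTo : IsOpen T := by
    rw [isOpen_iff_forall_mem_open]
    intro s hs
    obtain ⟨W, hsW, hW⟩ := hK s (f.base (ε.base s)) fun x hx => by rw [hpt x (hs x hx), hx]
    exact ⟨(W : Set S), fun u hu x hx => hb W hW x (by rw [hx]; exact hu), W.2, hsW⟩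
  -- `s₀ ∈ T`, so `T = S`
  have hs₀ : s₀ ∈ T := by
    obtain ⟨W, hsW, hW⟩ := hK s₀ y₀ h₀
    exact fun x hx => hb W hW x (by rw [hx]; exact hsW)
  have hT : T = Set.univ := IsClopen.eq_univ ⟨hTc, hTo⟩ ⟨s₀, hs₀⟩
  -- every point of `S` has a tube on which the two morphisms agree; the tubes cover `X`
  have hall : ∀ s : S, ∃ W : S.Opens, s ∈ W ∧ (p ⁻¹ᵁ W).ι ≫ f = (p ⁻¹ᵁ W).ι ≫ p ≫ ε ≫ f := fun s => by
    have hs : s ∈ T := by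
      rw [hT]
      exact Set.mem_univ _
    exact hK s (f.base (ε.base s)) fun x hx => by rw [hpt x (hs x hx), hx]
  choose W hsW hW using hall
  have hcov : IsOpenCover fun s : S => p ⁻¹ᵁ W s := by
    rw [IsOpenCover, eq_top_iff]
    intro x _
    rw [Opens.mem_iSup]
    exact ⟨p.base x, hsW (p.base x)⟩
  exact Scheme.Cover.hom_ext (X.openCoverOfIsOpenCover (fun s : S => p ⁻¹ᵁ W s) hcov) _ _ fun s => hW s

/-- **Prop. 1.3.1.4 holds** (discharge of `Lan2013_1314_rigidity`): the rigidity lemma in the printed hypotheses (`p` closed, open and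
flat with a section, `q` separated, `S` connected, `𝒪_S ⥲ p_*𝒪_X`, one fibre contracted), by `rigidity_of_surjective_of_isClosedMap`
(flatness and local noetherianity are not needed by the argument). [cite: Lan2013PELCompactifications, Prop. 1.3.1.4 (p. 58)]
[cite: MumfordFogartyKirwan1994, Ch. 6 §1 Proposition 6.1 (pp. 115–116)] -/
theorem Lan2013_1314_rigidity_holds : Lan2013_1314_rigidity := by
  intro X Y S _ _ _ _ p q f e hf he hpc hpo _ hq hStein h0
  obtain ⟨s, y, hsy⟩ := h0
  haveI := hq
  exact rigidity_of_surjective_of_isClosedMap hpc hpo f hf e he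
    (fun W => surjective_morphismRestrict_appTop_of_bijective_app p W (hStein _)) hsy

/-! ## Edition 2 — Cor. 1.3.1.12 and Lem. 1.3.1.18 (faithfulness) over an ARBITRARY base -/

section IsogenyFibres

open MonoidalCategory
open scoped MonObj
open Literature.AlgebraicGeometry.AbelianSchemes Literature.AlgebraicGeometry.GroupSchemes
open Literature.AlgebraicGeometry.Motives (AbelianVariety)

universe u

variable {S : Scheme.{u}} {A A' : AbelianSchemeOver S} (f : A.X ⟶ A'.X) [IsMonHom f]
  {Ω : Type u} [Field Ω] (t : Spec (.of Ω) ⟶ S)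

/-- **The kernel of the fibre `f_t : A_t → A′_t` is the base change of `ker(f) → S` along `t : Spec Ω → S`** (the cartesian
square print uses silently in Cor. 1.3.1.12 — «the rank of `ker(f)`» at `s` is the order of `ker(f_s̄)`): there is a morphism
`κ : Ker f_t → ker(f)` over `Ker f_t ↪ A_t → A` making `(κ, Ker f_t → Spec Ω; ker(f) → S, t)` cartesian.  Pasting of
`Ker f_t = A_t ×_{A′_t, e} Spec Ω` with `A_t = A′_t ×_{A′} A` (★ `Limits.isPullback_pullback_map_left`) along
`e_{A′_t} ≫ (A′_t → A′) = t ≫ e_{A′}` (★ `one_baseChange_left_comp_fst`), compared with `ker(f) = A ×_{A′, e} S`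
(★ `GroupSchemeKernel.isPullback_kerι_left`). [cite: Lan2013PELCompactifications, Cor. 1.3.1.12 (p. 60)]
[cite: GortzWedhorn2020, Definition 4.45 (2), p. 117] -/
theorem isPullback_ker_fibreHom :
    ∃ κ : AbelianVariety.Hom.ker (AbelianSchemeOver.fibreHom f t) ⟶ (GroupSchemeKernel.ker f).left,
      κ ≫ (GroupSchemeKernel.kerι f).left =
          AbelianVariety.Hom.kerι (AbelianSchemeOver.fibreHom f t) ≫ pullback.fst A.X.hom t ∧
      IsPullback κ (AbelianVariety.Hom.kerToSpec (AbelianSchemeOver.fibreHom f t)) (GroupSchemeKernel.ker f).hom t := by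
  -- Sq1: `ker f = A ×_{A′, e} S`
  have Sq1 := GroupSchemeKernel.isPullback_kerι_left f
  -- Sq2: `Ker f_t = A_t ×_{A′_t, e_t} Spec Ω` (`f_t` on schemes is `(Over.pullback t).map f`)
  have Sq2 : IsPullback (AbelianVariety.Hom.kerι (AbelianSchemeOver.fibreHom f t))
      (AbelianVariety.Hom.kerToSpec (AbelianSchemeOver.fibreHom f t)) ((Over.pullback t).map f).left
      (AbelianVariety.unitPt (A'.fibre t).toAbelianVariety) :=
    IsPullback.of_hasPullback _ _
  -- Sq3: `f_t` is the base change of `f` along `A′_t → A′`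
  have Sq3 := Literature.AlgebraicGeometry.Limits.isPullback_pullback_map_left t f
  -- the unit of `A′_t` lies over the unit of `A′`
  have hU : AbelianVariety.unitPt (A'.fibre t).toAbelianVariety ≫ pullback.fst A'.X.hom t =
      t ≫ (η[A'.X] : 𝟙_ (Over S) ⟶ A'.X).left :=
    A'.one_baseChange_left_comp_fst t
  have Big : IsPullback (AbelianVariety.Hom.kerι (AbelianSchemeOver.fibreHom f t) ≫ pullback.fst A.X.hom t)
      (AbelianVariety.Hom.kerToSpec (AbelianSchemeOver.fibreHom f t)) f.left
      (t ≫ (η[A'.X] : 𝟙_ (Over S) ⟶ A'.X).left) := by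
    convert Sq2.paste_horiz Sq3.flip using 1
    exact hU.symm
  have hw : (AbelianVariety.Hom.kerι (AbelianSchemeOver.fibreHom f t) ≫ pullback.fst A.X.hom t) ≫ f.left =
      (AbelianVariety.Hom.kerToSpec (AbelianSchemeOver.fibreHom f t) ≫ t) ≫ (η[A'.X] : 𝟙_ (Over S) ⟶ A'.X).left := by
    rw [Big.w, Category.assoc]
  refine ⟨Sq1.lift _ _ hw, Sq1.lift_fst _ _ hw, ?_⟩
  have hK : (GroupSchemeKernel.ker f).hom = (pullback.snd f η[A'.X]).left :=
    (Over.w (pullback.snd f η[A'.X])).symm.trans (Category.comp_id _)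
  rw [hK]
  refine IsPullback.of_right ?_ (Sq1.lift_snd _ _ hw) Sq1
  rw [Sq1.lift_fst]
  exact Big

/-- **Quasi-finite kernel over `S` ⇒ finite kernels on the fibres**: if `ker(f) → S` is locally quasi-finite, then
`Ker f_t → Spec Ω` is FINITE at every field-valued point `t` — it is quasi-finite (base change, `isPullback_ker_fibreHom`) and proper
(a closed subscheme of the proper `A_t`), and proper + quasi-finite ⇒ finite (Zariski's main theorem, Mathlib
`IsFinite.of_isProper_of_locallyQuasiFinite`; [EGA IV₃] 8.11.1). [cite: Lan2013PELCompactifications, Lem. 1.3.1.11 and Cor. 1.3.1.12 (p. 60)]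
[cite: GortzWedhorn2023, Prop. 27.176] -/
theorem isFinite_kerToSpec_fibreHom (hqf : LocallyQuasiFinite (GroupSchemeKernel.ker f).hom) :
    IsFinite (AbelianVariety.Hom.kerToSpec (AbelianSchemeOver.fibreHom f t)) := by
  obtain ⟨κ, -, hsq⟩ := isPullback_ker_fibreHom f t
  haveI : LocallyQuasiFinite (AbelianVariety.Hom.kerToSpec (AbelianSchemeOver.fibreHom f t)) :=
    MorphismProperty.of_isPullback hsq hqf
  haveI : IsProper (AbelianVariety.Hom.kerToSpec (AbelianSchemeOver.fibreHom f t)) := by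
    haveI := AbelianVariety.isProper_toSchemeHom (AbelianSchemeOver.fibreHom f t)
    exact MorphismProperty.pullback_snd _ _ inferInstance
  exact IsFinite.of_isProper_of_locallyQuasiFinite _

/-- **BRIDGE: an isogeny of abelian schemes in the sense of [Lan2013] Def. 1.3.1.9–1.3.1.10 (a surjective homomorphism whose kernel
`ker(f) → S` is quasi-finite) has fibres `f_t : A_t → A′_t` that are ISOGENIES OF ABELIAN VARIETIES (finite and surjective, ★
`AbelianVariety.IsIsogeny`) at every field-valued point `t`** — surjectivity by base change (★ `Limits.isPullback_pullback_map_left`),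
finiteness from the finite kernel (`isFinite_kerToSpec_fibreHom`) by the translation argument ★
`AbelianVariety.isFinite_toSchemeHom_of_isFinite_kerToSpec` ([GortzWedhorn2023] Prop. 27.176, step (2)).  This is the hypothesis
of the tree's ★ `AbelianSchemeOverIsogenyFinite` ([GortzWedhorn2023] Def. 27.176: «`f` is an isogeny if all `f_s̄` are»).
[cite: Lan2013PELCompactifications, Def. 1.3.1.9, Def. 1.3.1.10 and Lem. 1.3.1.11 (p. 60)] [cite: GortzWedhorn2023, Def. 27.176 and Prop. 27.176] -/
theorem isIsogeny_fibreHom_of_isIsogeny (hf : IsIsogeny f) :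
    AbelianVariety.IsIsogeny (AbelianSchemeOver.fibreHom f t) := by
  obtain ⟨-, hsurj, hqf, -⟩ := hf
  haveI := isFinite_kerToSpec_fibreHom f t hqf
  refine ⟨?_, AbelianVariety.isFinite_toSchemeHom_of_isFinite_kerToSpec _⟩
  change Surjective ((Over.pullback t).map f).left
  exact MorphismProperty.of_isPullback (Literature.AlgebraicGeometry.Limits.isPullback_pullback_map_left t f).flip hsurj

end IsogenyFibres

section Discharges

open MonoidalCategory
open scoped MonObj
open Literature.AlgebraicGeometry.AbelianSchemes Literature.AlgebraicGeometry.GroupSchemes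
open Literature.AlgebraicGeometry.Motives (AbelianVariety)

/-- **Cor. 1.3.1.12 holds** (discharge of `Lan2013_13112_kernel_finite_flat`, ARBITRARY base): for an isogeny `f : A → A′` of
abelian schemes, `ker(f) → S` is finite, flat and locally of finite presentation, and its rank is a locally constant function on
`S`.  By the bridge `isIsogeny_fibreHom_of_isIsogeny` every geometric fibre `f_s̄` is an isogeny of abelian varieties, so `f` is
finite (★ `isFinite_left_of_isIsogeny_fibreHom`, Zariski), flat (★ `flat_left_of_isIsogeny_fibreHom`: critère de platitude par
fibres over any base, [MumfordFogartyKirwan1994] Lemma 6.12) and locally of finite presentation (★ `locallyOfFinitePresentation_hom_left`);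
`ker(f) → S` is the base change of `f` along `e_{A′} : S → A′` (★ `GroupSchemeKernel.isPullback_kerι_left`), and the rank of a
finite flat morphism locally of finite presentation is locally constant (Mathlib `Scheme.Hom.isLocallyConstant_finrank`).
[cite: Lan2013PELCompactifications, Cor. 1.3.1.12 (p. 60)] [cite: GortzWedhorn2023, Cor. 27.177 (1)]
[cite: MumfordFogartyKirwan1994, Ch. 6 §2 Lemma 6.12 (p. 122)] -/
theorem Lan2013_13112_kernel_finite_flat_holds : Lan2013_13112_kernel_finite_flat := by
  intro S A A' f hf
  haveI : IsMonHom f := hf.1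
  have hiso : ∀ ⦃Ω : Type⦄ [Field Ω] [IsAlgClosed Ω] (t : Spec (.of Ω) ⟶ S),
      AbelianVariety.IsIsogeny (AbelianSchemeOver.fibreHom f t) :=
    fun Ω _ _ t => isIsogeny_fibreHom_of_isIsogeny f t hf
  haveI : IsFinite f.left := AbelianSchemeOver.isFinite_left_of_isIsogeny_fibreHom f hiso
  haveI : Flat f.left := AbelianSchemeOver.flat_left_of_isIsogeny_fibreHom f hiso
  haveI : LocallyOfFinitePresentation f.left := AbelianSchemeOver.locallyOfFinitePresentation_hom_left f
  -- `ker(f) → S` is the base change of `f` along the unit section of `A′`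
  have Sq1 := GroupSchemeKernel.isPullback_kerι_left f
  have hK : (GroupSchemeKernel.ker f).hom = (pullback.snd f η[A'.X]).left :=
    (Over.w (pullback.snd f η[A'.X])).symm.trans (Category.comp_id _)
  haveI h1 : IsFinite (GroupSchemeKernel.ker f).hom := by
    rw [hK]; exact MorphismProperty.of_isPullback Sq1 inferInstance
  haveI h2 : Flat (GroupSchemeKernel.ker f).hom := by
    rw [hK]; exact MorphismProperty.of_isPullback Sq1 inferInstance
  haveI h3 : LocallyOfFinitePresentation (GroupSchemeKernel.ker f).hom := by
    rw [hK]; exact MorphismProperty.of_isPullback Sq1 inferInstance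
  exact ⟨h1, h2, h3, Scheme.Hom.isLocallyConstant_finrank _⟩

/-- **Lem. 1.3.1.18, faithfulness, holds** (discharge of `Lan2013_13118_faithful`, ARBITRARY base): isogenies cancel isogenies on
the left — `i ≫ f = i ≫ f′` with `i : C → A` an isogeny gives `f = f′`.  By the bridge every geometric fibre of `i` is an isogeny of
abelian varieties, so `i` is flat (★ `flat_left_of_isIsogeny_fibreHom`); flat and surjective morphisms of schemes are epimorphisms
(Mathlib `epi_of_flat_of_surjective`, fpqc descent), so `i` cancels on underlying schemes, and `S`-morphisms are determined by their
underlying morphisms. [cite: Lan2013PELCompactifications, Lem. 1.3.1.18 (p. 61)] [cite: GortzWedhorn2023, Cor. 27.177 (1)] -/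
theorem Lan2013_13118_faithful_holds : Lan2013_13118_faithful := by
  intro S A A' C f f' i _ _ hi h
  haveI : IsMonHom i := hi.1
  have hiso : ∀ ⦃Ω : Type⦄ [Field Ω] [IsAlgClosed Ω] (t : Spec (.of Ω) ⟶ S),
      AbelianVariety.IsIsogeny (AbelianSchemeOver.fibreHom i t) :=
    fun Ω _ _ t => isIsogeny_fibreHom_of_isIsogeny i t hi
  haveI : Flat i.left := AbelianSchemeOver.flat_left_of_isIsogeny_fibreHom i hiso
  haveI : Surjective i.left := hi.2.1
  haveI : Epi i.left := AlgebraicGeometry.Flat.epi_of_flat_of_surjective _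
  have h' : i.left ≫ f.left = i.left ≫ f'.left := by rw [← Over.comp_left, h, Over.comp_left]
  exact Over.OverMorphism.ext ((cancel_epi i.left).mp h')

end Discharges

end Literature.AlgebraicGeometry.ModuliOfAbelianVarieties.Lan2013.Sec131QuasiIsogenies

end
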